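import Literature.NumberTheory.Automorphic.UnitaryGroupHolCotFormsArchCentre
import Summits.HodgeConjecture.HodgeConjecture.Theorems.F0P2aCohFormsContinuous
import HarnessLib

/-!
# FLOOR-0 P3c · line LH1 (closer stub `stub_S2sharp`, #80 S2♯) · «ZENTRUM» CENTRAL-ι sub-leaf — organ O-ARCHψ «`χ_∞ = 1` on cotangent `P`»

Cell hodgecm-mathlib (D-0151), FLOOR 0; crux item H413 = stmt-HodgeConjecture-24833 (route `HCCMUnconditional`); seat LH1-p01 (g4),
brick **(B2)** of LH1-plan (g4)'s memo `F0/P3c/LH1/LH1-plan/g4/G5-ZENTRUM-PRICING.v3_1.md` §5 and sketch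
`F0/P3c/LH1/LH1-plan/g4/ZentrumCentralIota.sketch.v5.lean` (organ `CotangentArchCentreTrivialLetter`, consumed by the proved head
`s2CentralIota_of_organs`).  THEOREMS ONLY (no `def`, no instance, no notation, no named fact, no `sorry`);
`--supports stmt-HodgeConjecture-24833`.
HC_CM is proved only modulo the 7 printed citations (2 remaining: hLiu418 = stmt-HodgeConjecture-24832, h413 = stmt-HodgeConjecture-24833)
until rung 0 closes; this file books nothing and discharges nothing booked (it pays an in-house organ of the LH1 pay-down of #80).

## What is proved
For the CM frame `(L, ι, H, T, hT)` (`Tᴴ · ι(H) · T = diag(1,1,−1)`), an automorphic measure `μ` (★ `AdelicGroupData.IsAutomorphicMeasure`: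
finite, positive on opens, left-invariant) and a discrete automorphic `P` of `U(H)(𝔸_{L⁺})`:
* §1 `apply_mul_archToAdelic_cmArchCenter_of_mem_cohForms` — EVERY `(1,0) ⊕ (0,1)` cohomological cotangent form `Φ ∈ cohForms …` of the
  frame (not only the holomorphic ones of ★ `apply_mul_archToAdelic_cmArchCenter`) is invariant under the archimedean centre:
  `Φ (x · (y·1₃, 1)) = Φ x` (`cohForms = hol ⊔ conj hol`, and conjugation commutes with evaluation);
* §2 `rightRegular_archCentre_toLp_toQuotFun_of_mem_cohForms`, `centralCharacter_archCentre_eq_one_of_mem_cohForms` — the ★ Z4 pair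
  (`UnitaryGroupHolCotFormsArchCentre` §5) for `cohForms` members: the `L²`-classes of the coordinates are fixed by `R((y,1)·1₃)`, so any
  character `ψ` through which ★ `adelicCenter` acts on `P` is `1` at `(y,1)` as soon as `P` contains a non-zero coordinate class;
* §3 **`centralCharacter_archCentre_eq_one_of_isCotangent`** — «`χ_∞ = 1`»: if `P` is hol- OR antihol-cotangent at the frame
  (★ `IsHolCotangentAt` ∕ ★ `IsAntiholCotangentAt`: `P` CONTAINS the coordinate classes of a NON-ZERO `Φ`), then `ψ((y,1)) = 1` for every
  archimedean norm-one unit `y` — the passage «non-zero form ⇒ non-zero class» is ★ `F0P2aCohFormsContinuous.exists_toLp_ne_zero_of_mem_cohForms_cm`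
  (continuity of cotangent forms of the frame + `μ` positive on opens, which `IsAutomorphicMeasure` carries); and
  **`cotangentArchCentreTrivial`** — the same in the EXACT ∀-telescope of the organ letter `CotangentArchCentreTrivialLetter` of the sketch
  (its definiteness binder `hdef` and degree binder `2 ≤ [L⁺:ℚ]` are carried and not used), so that the letter closes by `exact`.

## References
* [Liu2021] Y. Liu, Camb. J. Math. 9 (2021), proof of Prop. 4.13 Case 1, l. 2137 («the central character `χ` of `π` satisfies `χ_∞ = 1`»).
* [BorelJacquet1979] A. Borel, H. Jacquet, Corvallis PSPM 33.1, §4.1, §4.6.  [BorelWallach2000] 2nd ed., VII 2.10 (the two Hodge types).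
* Tree: ★ `Literature/…/UnitaryGroupHolCotFormsArchCentre` (Z4: `apply_mul_archToAdelic_cmArchCenter`, `centralCharacter_archCentre_eq_one`),
  ★ `Theorems/F0P2aCohFormsContinuous` (`exists_toLp_ne_zero_of_mem_cohForms_cm`), ★ `Theorems/H413SpectrumJunction` (`leftInvariant_of_mem_cohForms`).
-/

set_option autoImplicit false

-- the mandated namespace has the single-problem summit's repeated segment (`HodgeConjecture.HodgeConjecture`)
set_option linter.dupNamespace false

noncomputable section

namespace Summit.HodgeConjecture.HodgeConjecture.Cruxes.H413.F0P3cCotangentArchCentreTrivial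

open MeasureTheory NumberField NumberField.InfinitePlace MulAction
open scoped ENNReal Matrix ComplexOrder
open Literature.NumberTheory.Automorphic Literature.NumberTheory.Automorphic.UnitaryGroup
open Literature.NumberTheory.Automorphic.UnitaryGroup.CotangentForms
open Summit.HodgeConjecture.HodgeConjecture.Cruxes.H413

section Frame

variable (L : Type) [Field L] [NumberField L] [IsCMField L] (ι : L →+* ℂ) (H : Matrix (Fin 3) (Fin 3) L) (T : GL (Fin 3) ℂ)
  (hT : (T : Matrix (Fin 3) (Fin 3) ℂ)ᴴ * H.map ι * (T : Matrix (Fin 3) (Fin 3) ℂ) = Literature.Geometry.ComplexHyperbolic.BallModel.J)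

/-! ## §1 Cohomological cotangent forms (both Hodge types) are invariant under the archimedean centre -/

/-- **`Φ (x · (y·1₃, 1)) = Φ x` for every `Φ ∈ cohForms …` of the frame** (holomorphic AND antiholomorphic cotangent forms): `cohForms` is
`holCotForms ⊔ conjFun (holCotForms)`, the holomorphic summand is ★ `apply_mul_archToAdelic_cmArchCenter`, and `conjFun Ψ x = star (Ψ x)`.
[cite: BorelWallach2000, VII 2.10] [cite: BorelJacquet1979, §4.1] -/
theorem apply_mul_archToAdelic_cmArchCenter_of_mem_cohForms
    {Φ : (adelicGroupData (↥(maximalRealSubfield L)) L (IsCMField.complexConj L) 3 H).Adelic → (Fin 2 → ℂ)}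
    (hΦ : Φ ∈ cohForms (↥(maximalRealSubfield L)) L (IsCMField.complexConj L) 3 H (cmArchSection L ι H T hT)
      (cmCompactFactor L ι H T hT))
    (y : relNormOneInfUnits (↥(maximalRealSubfield L)) L)
    (x : (adelicGroupData (↥(maximalRealSubfield L)) L (IsCMField.complexConj L) 3 H).Adelic) :
    Φ (x * archToAdelic (↥(maximalRealSubfield L)) L (IsCMField.complexConj L) 3 H (cmArchCenter L 3 H y)) = Φ x := by
  obtain ⟨a, ha, b, hb, rfl⟩ := Submodule.mem_sup.mp hΦ
  obtain ⟨b', hb', rfl⟩ := Submodule.mem_map.mp hb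
  simp only [Pi.add_apply, conjFun_apply, apply_mul_archToAdelic_cmArchCenter L ι H T hT ha,
    apply_mul_archToAdelic_cmArchCenter L ι H T hT hb']

/-- Coordinatewise left-invariance of a cohomological cotangent form under `A_G · U(H)(L⁺)` (★ `SpectrumJunction.leftInvariant_of_mem_cohForms`,
read on the coordinate `j`). [cite: BorelJacquet1979, §4.2] -/
theorem left_inv_apply_of_mem_cohForms
    {Φ : (adelicGroupData (↥(maximalRealSubfield L)) L (IsCMField.complexConj L) 3 H).Adelic → (Fin 2 → ℂ)}
    (hΦ : Φ ∈ cohForms (↥(maximalRealSubfield L)) L (IsCMField.complexConj L) 3 H (cmArchSection L ι H T hT)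
      (cmCompactFactor L ι H T hT)) (j : Fin 2) :
    ∀ γ ∈ (adelicGroupData (↥(maximalRealSubfield L)) L (IsCMField.complexConj L) 3 H).quotientSubgroup, ∀ g,
      (fun g => Φ g j) (γ * g) = (fun g => Φ g j) g := by
  intro γ hγ g
  simp only [SpectrumJunction.leftInvariant_of_mem_cohForms hΦ γ hγ g]

/-! ## §2 The archimedean centre fixes the coordinate classes of `cohForms` members; central characters are `1` on it -/

variable {μ : Measure (adelicGroupData (↥(maximalRealSubfield L)) L (IsCMField.complexConj L) 3 H).automorphicQuotient}
  [SMulInvariantMeasure (adelicGroupData (↥(maximalRealSubfield L)) L (IsCMField.complexConj L) 3 H).Adelic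
    (adelicGroupData (↥(maximalRealSubfield L)) L (IsCMField.complexConj L) 3 H).automorphicQuotient μ]

/-- **`R((y,1)·1₃) [Φ_j] = [Φ_j]`** for every `Φ ∈ cohForms …` of the frame (★ `rightRegular_archCentre_toLp_toQuotFun` extended from the
holomorphic to both Hodge types): `R(z)[f] = [f(z⁻¹ • ·)]` (Mathlib `DomMulAct.mk_smul_toLp`) and `Φ_j(w⁻¹ z) = Φ_j(w⁻¹)` by §1.
[cite: BorelJacquet1979, §4.6] -/
theorem rightRegular_archCentre_toLp_toQuotFun_of_mem_cohForms
    {Φ : (adelicGroupData (↥(maximalRealSubfield L)) L (IsCMField.complexConj L) 3 H).Adelic → (Fin 2 → ℂ)}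
    (hΦ : Φ ∈ cohForms (↥(maximalRealSubfield L)) L (IsCMField.complexConj L) 3 H (cmArchSection L ι H T hT)
      (cmCompactFactor L ι H T hT))
    (y : relNormOneInfUnits (↥(maximalRealSubfield L)) L) (j : Fin 2)
    (h : MemLp (toQuotFun (adelicGroupData (↥(maximalRealSubfield L)) L (IsCMField.complexConj L) 3 H) fun g => Φ g j) 2 μ) :
    (adelicGroupData (↥(maximalRealSubfield L)) L (IsCMField.complexConj L) 3 H).rightRegular μ
        (archToAdelic (↥(maximalRealSubfield L)) L (IsCMField.complexConj L) 3 H (cmArchCenter L 3 H y)) (h.toLp _) =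
      h.toLp _ := by
  have hleft := left_inv_apply_of_mem_cohForms L ι H T hT hΦ j
  have hfun : (fun x : (adelicGroupData (↥(maximalRealSubfield L)) L (IsCMField.complexConj L) 3 H).automorphicQuotient =>
      toQuotFun (adelicGroupData (↥(maximalRealSubfield L)) L (IsCMField.complexConj L) 3 H) (fun g => Φ g j)
        ((archToAdelic (↥(maximalRealSubfield L)) L (IsCMField.complexConj L) 3 H (cmArchCenter L 3 H y))⁻¹ • x)) =
      toQuotFun (adelicGroupData (↥(maximalRealSubfield L)) L (IsCMField.complexConj L) 3 H) (fun g => Φ g j) := by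
    funext x
    have hsurj : Function.Surjective
        (adelicGroupData (↥(maximalRealSubfield L)) L (IsCMField.complexConj L) 3 H).toAutomorphicQuotient :=
      QuotientGroup.mk_surjective
    obtain ⟨w, rfl⟩ := hsurj x
    show toQuotFun (adelicGroupData (↥(maximalRealSubfield L)) L (IsCMField.complexConj L) 3 H) (fun g => Φ g j)
        ((adelicGroupData (↥(maximalRealSubfield L)) L (IsCMField.complexConj L) 3 H).toAutomorphicQuotient
          ((archToAdelic (↥(maximalRealSubfield L)) L (IsCMField.complexConj L) 3 H (cmArchCenter L 3 H y))⁻¹ * w)) = _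
    rw [toQuotFun_mk hleft, toQuotFun_mk hleft, mul_inv_rev, inv_inv]
    show Φ (w⁻¹ * archToAdelic (↥(maximalRealSubfield L)) L (IsCMField.complexConj L) 3 H (cmArchCenter L 3 H y)) j = Φ w⁻¹ j
    rw [apply_mul_archToAdelic_cmArchCenter_of_mem_cohForms L ι H T hT hΦ y w⁻¹]
  rw [AdelicGroupData.rightRegular_apply, DomMulAct.mk_smul_toLp]
  exact MemLp.toLp_congr _ _ (Filter.EventuallyEq.of_eq hfun)

/-- **«`χ_∞ = 1`» for `cohForms` members**: if ★ `adelicCenter` acts on the discrete automorphic `P` through `ψ`, `Φ ∈ cohForms …` of the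
frame has its `j`-th coordinate class in `P` and that class is non-zero, then `ψ((y, 1)) = 1` for every archimedean norm-one unit `y`
(★ `centralCharacter_archCentre_eq_one` extended to both Hodge types; `(y·1₃, 1) = (y,1)·1₃` is ★ `archToAdelic_cmArchCenter`).
[cite: Liu2021, proof of Prop. 4.13 Case 1, l. 2137] [cite: BorelJacquet1979, §4.6] -/
theorem centralCharacter_archCentre_eq_one_of_mem_cohForms
    (P : DiscreteAutomorphicRep (adelicGroupData (↥(maximalRealSubfield L)) L (IsCMField.complexConj L) 3 H) μ)
    {ψ : ↥(adelicOne (↥(maximalRealSubfield L)) L (IsCMField.complexConj L)) →* ℂˣ}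
    (hψ : ∀ (u : ↥(adelicOne (↥(maximalRealSubfield L)) L (IsCMField.complexConj L))) (f : P.space.toSubmodule),
      P.space.toContRep (adelicCenter (↥(maximalRealSubfield L)) L (IsCMField.complexConj L) 3 H u) f = ((ψ u : ℂˣ) : ℂ) • f)
    {Φ : (adelicGroupData (↥(maximalRealSubfield L)) L (IsCMField.complexConj L) 3 H).Adelic → (Fin 2 → ℂ)}
    (hΦ : Φ ∈ cohForms (↥(maximalRealSubfield L)) L (IsCMField.complexConj L) 3 H (cmArchSection L ι H T hT)
      (cmCompactFactor L ι H T hT))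
    {j : Fin 2} (h : MemLp (toQuotFun (adelicGroupData (↥(maximalRealSubfield L)) L (IsCMField.complexConj L) 3 H) fun g => Φ g j) 2 μ)
    (hmem : h.toLp _ ∈ P.space.toSubmodule) (hne : h.toLp _ ≠ 0)
    (y : relNormOneInfUnits (↥(maximalRealSubfield L)) L) :
    ψ ((cmAdelicOneEquivRelNormOne L).symm (relNormOneInfToIdeles (↥(maximalRealSubfield L)) L y)) = 1 := by
  have hfix := rightRegular_archCentre_toLp_toQuotFun_of_mem_cohForms L ι H T hT (μ := μ) hΦ y j h
  rw [archToAdelic_cmArchCenter] at hfix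
  set u := (cmAdelicOneEquivRelNormOne L).symm (relNormOneInfToIdeles (↥(maximalRealSubfield L)) L y) with hu
  have hv : P.space.toContRep (adelicCenter (↥(maximalRealSubfield L)) L (IsCMField.complexConj L) 3 H u) ⟨_, hmem⟩ = ⟨_, hmem⟩ :=
    Subtype.ext hfix
  have hne' : (⟨_, hmem⟩ : P.space.toSubmodule) ≠ 0 := fun h0 => hne (congrArg Subtype.val h0)
  have hh := hψ u ⟨_, hmem⟩
  rw [hv] at hh
  have h' : ((ψ u : ℂˣ) : ℂ) • (⟨_, hmem⟩ : P.space.toSubmodule) = (1 : ℂ) • ⟨_, hmem⟩ := by rw [one_smul]; exact hh.symm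
  exact Units.ext (smul_left_injective ℂ hne' h')

end Frame

/-! ## §3 «`χ_∞ = 1`» for hol- or antihol-COTANGENT `P` (organ O-ARCHψ of the «ZENTRUM» CENTRAL-ι sub-leaf) -/

section Cotangent

variable (L : Type) [Field L] [NumberField L] [IsCMField L] (ι : L →+* ℂ) (H : Matrix (Fin 3) (Fin 3) L) (T : GL (Fin 3) ℂ)
  (hT : (T : Matrix (Fin 3) (Fin 3) ℂ)ᴴ * H.map ι * (T : Matrix (Fin 3) (Fin 3) ℂ) = Literature.Geometry.ComplexHyperbolic.BallModel.J)
  {μ : Measure (adelicGroupData (↥(maximalRealSubfield L)) L (IsCMField.complexConj L) 3 H).automorphicQuotient}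

/-- **«`χ_∞ = 1`» for a cotangent `P` [Liu2021, l. 2137].**  For an AUTOMORPHIC measure `μ` (★ `IsAutomorphicMeasure`: in particular positive on
non-empty open sets and left-invariant) and a discrete automorphic `P` of `U(H)(𝔸_{L⁺})` which is holomorphic- or antiholomorphic-cotangent at
the frame (★ `IsHolCotangentAt` ∕ ★ `IsAntiholCotangentAt`: `P` contains the coordinate classes of a NON-ZERO cotangent form `Φ`), every character
`ψ` through which the adèlic centre ★ `adelicCenter` acts on `P` is trivial on the archimedean centre: `ψ((y,1)) = 1` for all `y ∈ U(1)(L⁺ ⊗ ℝ)`.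
The non-zero form has a non-zero coordinate CLASS by ★ `F0P2aCohFormsContinuous.exists_toLp_ne_zero_of_mem_cohForms_cm` (cotangent forms of the
frame are continuous; `μ` charges opens), and §2 concludes.  No definiteness or degree hypothesis is needed.
[cite: Liu2021, proof of Prop. 4.13 Case 1, l. 2137] [cite: BorelJacquet1979, §4.6] -/
theorem centralCharacter_archCentre_eq_one_of_isCotangent
    [(adelicGroupData (↥(maximalRealSubfield L)) L (IsCMField.complexConj L) 3 H).IsAutomorphicMeasure μ]
    (P : DiscreteAutomorphicRep (adelicGroupData (↥(maximalRealSubfield L)) L (IsCMField.complexConj L) 3 H) μ)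
    (hP : P.IsHolCotangentAt (cmArchSection L ι H T hT) (cmCompactFactor L ι H T hT) ∨
      P.IsAntiholCotangentAt (cmArchSection L ι H T hT) (cmCompactFactor L ι H T hT))
    {ψ : ↥(adelicOne (↥(maximalRealSubfield L)) L (IsCMField.complexConj L)) →* ℂˣ}
    (hψ : ∀ (u : ↥(adelicOne (↥(maximalRealSubfield L)) L (IsCMField.complexConj L))) (f : P.space.toSubmodule),
      P.space.toContRep (adelicCenter (↥(maximalRealSubfield L)) L (IsCMField.complexConj L) 3 H u) f = ((ψ u : ℂˣ) : ℂ) • f)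
    (y : relNormOneInfUnits (↥(maximalRealSubfield L)) L) :
    ψ ((cmAdelicOneEquivRelNormOne L).symm (relNormOneInfToIdeles (↥(maximalRealSubfield L)) L y)) = 1 := by
  -- a non-zero `Φ ∈ cohForms …` whose coordinate classes lie in `P`
  obtain ⟨Φ, hΦ, hne, hcont⟩ : ∃ Φ ∈ cohForms (↥(maximalRealSubfield L)) L (IsCMField.complexConj L) 3 H (cmArchSection L ι H T hT)
      (cmCompactFactor L ι H T hT), Φ ≠ 0 ∧ P.ContainsForm Φ := by
    rcases hP with ⟨Φ, hΦ, hne, hcont⟩ | ⟨Φ, hΦ, hne, hcont⟩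
    · exact ⟨Φ, holCotForms_le_cohForms hΦ, hne, hcont⟩
    · exact ⟨Φ, Submodule.mem_sup_right hΦ, hne, hcont⟩
  -- its coordinates are square-integrable on the quotient (part of `ContainsForm`), and one coordinate class is non-zero
  have hm : ∀ j : Fin 2,
      MemLp (toQuotFun (adelicGroupData (↥(maximalRealSubfield L)) L (IsCMField.complexConj L) 3 H) fun g => Φ g j) 2 μ :=
    fun j => (hcont j).choose
  obtain ⟨j, hj⟩ := F0P2aCohFormsContinuous.exists_toLp_ne_zero_of_mem_cohForms_cm (hT := hT) hΦ hne hm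
  exact centralCharacter_archCentre_eq_one_of_mem_cohForms L ι H T hT P hψ hΦ (hm j) (hcont j).choose_spec hj y

end Cotangent

/-- **Organ O-ARCHψ «`χ_∞ = 1` on cotangent `P`» of the «ZENTRUM» CENTRAL-ι sub-leaf, in the EXACT ∀-telescope of the organ letter
`CotangentArchCentreTrivialLetter`** of LH1-plan (g4)'s sketch `ZentrumCentralIota.sketch.v5.lean` (so that the letter closes by `exact
cotangentArchCentreTrivial`): the frame's definiteness binder (`H` definite at the places `≠ ι`) and degree binder (`2 ≤ [L⁺:ℚ]`) are carried, as the
letter carries them, and not used — `centralCharacter_archCentre_eq_one_of_isCotangent` needs neither.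
[cite: Liu2021, proof of Prop. 4.13 Case 1, l. 2137] [cite: BorelJacquet1979, §4.6] -/
theorem cotangentArchCentreTrivial :
    ∀ (L : Type) [Field L] [NumberField L] [IsCMField L] (ι : L →+* ℂ) (H : Matrix (Fin 3) (Fin 3) L) (T : GL (Fin 3) ℂ)
      (hT : (T : Matrix (Fin 3) (Fin 3) ℂ)ᴴ * H.map ι * (T : Matrix (Fin 3) (Fin 3) ℂ) = Literature.Geometry.ComplexHyperbolic.BallModel.J),
      (∀ τ' : L →+* ℂ, InfinitePlace.mk τ' ≠ InfinitePlace.mk ι → (H.map τ').PosDef) →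
      2 ≤ Module.finrank ℚ ↥(maximalRealSubfield L) →
      ∀ (μ : Measure (adelicGroupData (↥(maximalRealSubfield L)) L (IsCMField.complexConj L) 3 H).automorphicQuotient)
        [(adelicGroupData (↥(maximalRealSubfield L)) L (IsCMField.complexConj L) 3 H).IsAutomorphicMeasure μ]
        (P : DiscreteAutomorphicRep (adelicGroupData (↥(maximalRealSubfield L)) L (IsCMField.complexConj L) 3 H) μ),
        (P.IsHolCotangentAt (cmArchSection L ι H T hT) (cmCompactFactor L ι H T hT) ∨
          P.IsAntiholCotangentAt (cmArchSection L ι H T hT) (cmCompactFactor L ι H T hT)) →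
        ∀ (ψ : ↥(adelicOne (↥(maximalRealSubfield L)) L (IsCMField.complexConj L)) →* ℂˣ),
          (∀ (u : ↥(adelicOne (↥(maximalRealSubfield L)) L (IsCMField.complexConj L))) (f : P.space.toSubmodule),
            P.space.toContRep (adelicCenter (↥(maximalRealSubfield L)) L (IsCMField.complexConj L) 3 H u) f = ((ψ u : ℂˣ) : ℂ) • f) →
          ∀ y : ↥(relNormOneInfUnits (↥(maximalRealSubfield L)) L),
            ψ ((cmAdelicOneEquivRelNormOne L).symm (relNormOneInfToIdeles (↥(maximalRealSubfield L)) L y)) = 1 :=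
  fun L _ _ _ ι H T hT _ _ _ _ P hP _ hψ y => centralCharacter_archCentre_eq_one_of_isCotangent L ι H T hT P hP hψ y

end Summit.HodgeConjecture.HodgeConjecture.Cruxes.H413.F0P3cCotangentArchCentreTrivial

end
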